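import Literature.Analysis.FluidPDE.CaloricBackwardKernels
import Literature.Analysis.FluidPDE.CaloricPotentialContinuity
import HarnessLib

/-!
# Time-truncated backward heat kernels are in `L^b(ℝ × E)`

Analysis/FluidPDE support file (everything proved) for the discharge of the named fact
`Literature.Analysis.FluidPDE.HeatDivFormInteriorImprovement` (`NSBoundedVorticityReduction.lean`;
Robinson–Rodrigo–Sadowski 2016, §13.3.2 Step 2 with Thms. D.6–D.7: the interior `L^m → L^r`
improvement for `∂ₜw - Δw = div g`). The printed proofs of Thms. D.6–D.7 in the isotropic case
(`l' = r'`, resp. `m' = r'`, "Case 2", pp. 295–296) apply Young's inequality on `ℝⁿ × [0, T)` with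
the space–time heat kernel, resp. its gradient, in `L^a_{t,x}` of a **finite** time window:
`‖t^{-n/2} e^{-|x|²/4t}‖_{L^a_x} = C t^{-(n/2)(1 - 1/a)}`, "an element of `L¹_t`" iff
`(n/2)(a - 1) < 1`, and for the gradient the extra factor `t^{-1/2}` gives the condition
`(n(a - 1) + a)/2 < 1`, i.e. `a < (n + 2)/(n + 1)` (`= 5/4` for `n = 3`; `1 + 2/n = 5/3` for the
kernel itself).

This file proves exactly these memberships for the accepted backward kernels of
`CaloricBackwardKernels.lean`, truncated to the time strip `-T < τ < 0` (no new definitions: the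
truncation is `Set.indicator (Ioo (-T) 0 ×ˢ univ) (backKernel κ)`):

* `indicator_strip_backKernel_of_lt` — the truncation agrees with `backKernel κ` wherever
  `-T < τ` (the kernel vanishes for `τ ≥ 0` anyway);
* `lintegral_rpow_enorm_indicator_strip_backKernel_le` — Tonelli: a slice bound
  `∫ |κ a|^b ≤ C a^{-θ}` on `0 < a < T` gives `∫∫ |k_T|^b ≤ C ∫_{-T}^0 (-τ)^{-θ} dτ`, finite for
  `θ < 1` (`lintegral_Ioo_neg_rpow_lt_top`), whence `memLp_indicator_strip_backKernel`;
* the slice bounds `lintegral_rpow_enorm_heatKernel_le` (`∫ G_a^b ≤ (4πa)^{-n(b-1)/2}`, from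
  `G_a ≤ (4πa)^{-n/2}` and `∫ G_a = 1`) and `lintegral_rpow_enorm_heatKernelGrad_le`
  (`∫ |∂ᵥG_a|^b ≤ C(n, b) ‖v‖^b a^{-(n(b-1)+b)/2}`, from the Gaussian bound
  `‖∇G_a(y)‖ ≤ (4πa)^{-n/2} a^{-1/2} e^{-‖y‖²/8a}` and `∫ e^{-c‖y‖²} = (π/c)^{n/2}`);
* `memLp_indicator_strip_backKernel_heatKernel` (`1 ≤ b < 1 + 2/n`) and
  `memLp_indicator_strip_backKernel_heatKernelGrad` (`1 ≤ b < 1 + 1/(n+1)`), and the reflected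
  versions `memLp_reflect_of_memLp` (`q ↦ k(-q)`, negation invariance of Lebesgue measure on
  `ℝ × E`), which are the forward kernels entering the Duhamel representation.

## References

* J. C. Robinson, J. L. Rodrigo, W. Sadowski, *The Three-Dimensional Navier–Stokes Equations*,
  CUP 2016, App. D.3, Thms. D.6–D.7 and their proofs (pp. 294–296), Thm. D.4 (D.6)–(D.7).
  [`RobinsonRodrigoSadowskiCUP2016`]
-/

noncomputable section

open MeasureTheory Set Function Filter Real
open scoped ENNReal NNReal Topology

namespace Literature.Analysis.FluidPDE

variable {E : Type*} [NormedAddCommGroup E] [InnerProductSpace ℝ E] [FiniteDimensional ℝ E]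
  [MeasurableSpace E] [BorelSpace E]

/-! ### The truncation -/

omit [NormedAddCommGroup E] [InnerProductSpace ℝ E] [FiniteDimensional ℝ E] [MeasurableSpace E]
  [BorelSpace E] in
/-- The time-truncated backward kernel `1_{(-T,0) × E} · backKernel κ` agrees with `backKernel κ`
at every point with `-T < τ` (for `τ ≥ 0` both vanish). [folklore] -/
theorem indicator_strip_backKernel_of_lt (κ : ℝ → E → ℝ) {T : ℝ} {q : ℝ × E} (hq : -T < q.1) :
    (Ioo (-T) 0 ×ˢ (univ : Set E)).indicator (backKernel κ) q = backKernel κ q := by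
  by_cases h0 : q.1 < 0
  · exact indicator_of_mem (show q ∈ Ioo (-T) 0 ×ˢ (univ : Set E) from ⟨⟨hq, h0⟩, mem_univ _⟩) _
  · have hz : backKernel κ q = 0 := backKernel_of_nonneg κ (not_lt.1 h0) q.2
    rw [hz, indicator_apply]
    split_ifs <;> simp [hz]

omit [NormedAddCommGroup E] [InnerProductSpace ℝ E] [FiniteDimensional ℝ E] [MeasurableSpace E]
  [BorelSpace E] in
/-- The time-truncated backward kernel vanishes at points with `τ ≤ -T`. [folklore] -/
theorem indicator_strip_backKernel_of_le (κ : ℝ → E → ℝ) {T : ℝ} {q : ℝ × E} (hq : q.1 ≤ -T) :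
    (Ioo (-T) 0 ×ˢ (univ : Set E)).indicator (backKernel κ) q = 0 :=
  indicator_of_notMem (fun h => (not_lt.2 hq) h.1.1) _

omit [NormedAddCommGroup E] [InnerProductSpace ℝ E] [FiniteDimensional ℝ E] [MeasurableSpace E]
  [BorelSpace E] in
/-- The truncation is dominated by the kernel: `|k_T| ≤ |k|` pointwise. [folklore] -/
theorem abs_indicator_strip_backKernel_le (κ : ℝ → E → ℝ) (T : ℝ) (q : ℝ × E) :
    |(Ioo (-T) 0 ×ˢ (univ : Set E)).indicator (backKernel κ) q| ≤ |backKernel κ q| := by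
  rw [indicator_apply]
  split_ifs <;> simp

/-! ### Finiteness of the time integral -/

/-- `∫_{-T}^0 (-τ)^{-θ} dτ < ∞` for `θ < 1` (reflection to `∫₀ᵀ σ^{-θ} dσ`). [folklore] -/
theorem lintegral_Ioo_neg_rpow_lt_top {θ T : ℝ} (hθ : θ < 1) (hT : 0 < T) :
    ∫⁻ τ in Ioo (-T) 0, ENNReal.ofReal ((-τ) ^ (-θ)) < ⊤ := by
  have hmp : MeasurePreserving (Neg.neg : ℝ → ℝ) volume volume := Measure.measurePreserving_neg _
  have hpre : (Neg.neg : ℝ → ℝ) ⁻¹' Ioo 0 T = Ioo (-T) 0 := by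
    ext τ
    simp only [mem_preimage, mem_Ioo]
    constructor <;> rintro ⟨h1, h2⟩ <;> constructor <;> linarith
  have key := hmp.setLIntegral_comp_preimage_emb (Homeomorph.neg ℝ).measurableEmbedding
    (fun σ : ℝ => ENNReal.ofReal (σ ^ (-θ))) (Ioo 0 T)
  rw [hpre] at key
  rw [key]
  have hint : IntegrableOn (fun σ : ℝ => σ ^ (-θ)) (Ioo 0 T) :=
    (intervalIntegral.integrableOn_Ioo_rpow_iff hT).2 (by linarith)
  exact hint.lintegral_lt_top

/-! ### Tonelli over the strip -/

/-- **The `L^b` mass of a truncated backward kernel from slice bounds**: if `backKernel κ` is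
measurable and `∫ |κ a(y)|^b dy ≤ C a^{-θ}` for `0 < a < T`, then
`∫∫ |k_T|^b ≤ C ∫_{-T}^0 (-τ)^{-θ} dτ`, `k_T = 1_{(-T,0)×E} backKernel κ` (Tonelli on the strip).
[cite: RobinsonRodrigoSadowskiCUP2016, Thm. D.6 proof, Case 2 (p. 295)] -/
theorem lintegral_rpow_enorm_indicator_strip_backKernel_le {κ : ℝ → E → ℝ}
    (hκ : Measurable (backKernel κ)) {b : ℝ} (hb : 0 < b) (T : ℝ) (C : ℝ≥0∞) {θ : ℝ}
    (hslice : ∀ a : ℝ, 0 < a → a < T → ∫⁻ y, ‖κ a y‖ₑ ^ b ≤ C * ENNReal.ofReal (a ^ (-θ))) :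
    ∫⁻ q, ‖(Ioo (-T) 0 ×ˢ (univ : Set E)).indicator (backKernel κ) q‖ₑ ^ b ≤
      C * ∫⁻ τ in Ioo (-T) 0, ENNReal.ofReal ((-τ) ^ (-θ)) := by
  set S : Set (ℝ × E) := Ioo (-T) 0 ×ˢ (univ : Set E) with hS_def
  have hS : MeasurableSet S := measurableSet_Ioo.prod MeasurableSet.univ
  have h1 : (fun q => ‖S.indicator (backKernel κ) q‖ₑ ^ b) =
      S.indicator (fun q => ‖backKernel κ q‖ₑ ^ b) := by
    funext q
    by_cases hq : q ∈ S
    · simp [indicator_of_mem hq]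
    · simp [indicator_of_notMem hq, ENNReal.zero_rpow_of_pos hb]
  have hmeas : Measurable fun q : ℝ × E => ‖backKernel κ q‖ₑ ^ b := hκ.enorm.pow_const b
  rw [h1, lintegral_indicator hS, hS_def, Measure.volume_eq_prod,
    setLIntegral_prod _ hmeas.aemeasurable]
  have htime : Measurable fun τ : ℝ => ENNReal.ofReal ((-τ) ^ (-θ)) :=
    ENNReal.measurable_ofReal.comp (measurable_neg.pow_const _)
  rw [← lintegral_const_mul _ htime]
  refine setLIntegral_mono' measurableSet_Ioo fun τ hτ => ?_
  rw [Measure.restrict_univ]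
  have heq : ∀ y : E, backKernel κ (τ, y) = κ (-τ) y := fun y => backKernel_of_neg κ hτ.2 y
  simp_rw [heq]
  have h := hslice (-τ) (neg_pos.2 hτ.2) (by linarith [hτ.1])
  simpa only [neg_neg] using h

/-- **Membership of a truncated backward kernel in `L^b(ℝ × E)`** (`1 ≤ b < ∞`) from slice bounds
`∫ |κ a|^b ≤ C a^{-θ}` (`0 < a < T`) with `C < ∞`, `θ < 1`. [cite: RobinsonRodrigoSadowskiCUP2016, Thms. D.6–D.7 proofs, Case 2 (pp. 295–296)] -/
theorem memLp_indicator_strip_backKernel {κ : ℝ → E → ℝ} (hκ : Measurable (backKernel κ))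
    {b : ℝ≥0∞} (hb1 : 1 ≤ b) (hbtop : b ≠ ⊤) {T θ : ℝ} (hT : 0 < T) (hθ : θ < 1) {C : ℝ≥0∞}
    (hC : C ≠ ⊤)
    (hslice : ∀ a : ℝ, 0 < a → a < T →
      ∫⁻ y, ‖κ a y‖ₑ ^ b.toReal ≤ C * ENNReal.ofReal (a ^ (-θ))) :
    MemLp ((Ioo (-T) 0 ×ˢ (univ : Set E)).indicator (backKernel κ)) b
      (volume : Measure (ℝ × E)) := by
  have hS : MeasurableSet (Ioo (-T) 0 ×ˢ (univ : Set E)) := measurableSet_Ioo.prod MeasurableSet.univ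
  have hb0 : b ≠ 0 := (zero_lt_one.trans_le hb1).ne'
  have hbpos : 0 < b.toReal := ENNReal.toReal_pos hb0 hbtop
  refine ⟨(hκ.indicator hS).aestronglyMeasurable, ?_⟩
  rw [eLpNorm_eq_lintegral_rpow_enorm_toReal hb0 hbtop]
  refine ENNReal.rpow_lt_top_of_nonneg (by positivity) (ne_of_lt ?_)
  refine (lintegral_rpow_enorm_indicator_strip_backKernel_le hκ hbpos T C hslice).trans_lt ?_
  exact ENNReal.mul_lt_top hC.lt_top (lintegral_Ioo_neg_rpow_lt_top hθ hT)

/-- Lebesgue measure on `ℝ × E` is negation invariant, so `q ↦ k(-q)` is in `L^b` with `k`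
(the reflected, forward kernels). [folklore] -/
theorem memLp_reflect_of_memLp {k : ℝ × E → ℝ} {b : ℝ≥0∞}
    (hk : MemLp k b (volume : Measure (ℝ × E))) :
    MemLp (fun q => k (-q)) b (volume : Measure (ℝ × E)) := by
  haveI := isNegInvariant_volume_real_prod (E := E)
  exact hk.comp_measurePreserving (Measure.measurePreserving_neg (volume : Measure (ℝ × E)))

/-! ### Slice bounds for the heat kernel and its gradient -/

/-- **`∫ G_a^b ≤ (4π)^{-n(b-1)/2} a^{-n(b-1)/2}`** for `a > 0`, `b ≥ 1` (`G_a ≤ (4πa)^{-n/2}` and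
`∫ G_a = 1`; Robinson–Rodrigo–Sadowski 2016, proof of Thm. D.4 / Thm. D.6 Case 2:
`‖t^{-n/2}e^{-|x|²/4t}‖_{L^a_x} = C t^{-n/2} t^{n/2a}`). [cite: RobinsonRodrigoSadowskiCUP2016, Thm. D.6 proof, Case 2 (p. 295)] -/
theorem lintegral_rpow_enorm_heatKernel_le {a : ℝ} (ha : 0 < a) {b : ℝ} (hb : 1 ≤ b) :
    ∫⁻ y, ‖UnboundedOperators.heatKernel (E := E) a y‖ₑ ^ b ≤
      ENNReal.ofReal ((4 * π) ^ (-((Module.finrank ℝ E : ℝ) * (b - 1) / 2))) *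
        ENNReal.ofReal (a ^ (-((Module.finrank ℝ E : ℝ) * (b - 1) / 2))) := by
  set n : ℝ := (Module.finrank ℝ E : ℝ) with hn
  set M : ℝ≥0∞ := ENNReal.ofReal ((4 * π * a) ^ (-n / 2)) with hM
  have hpt : ∀ y : E, ‖UnboundedOperators.heatKernel (E := E) a y‖ₑ ^ b ≤
      M ^ (b - 1) * ‖UnboundedOperators.heatKernel (E := E) a y‖ₑ := by
    intro y
    have hle : ‖UnboundedOperators.heatKernel (E := E) a y‖ₑ ≤ M :=
      UnboundedOperators.enorm_heatKernel_le ha y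
    calc ‖UnboundedOperators.heatKernel (E := E) a y‖ₑ ^ b
        = ‖UnboundedOperators.heatKernel (E := E) a y‖ₑ ^ (b - 1) *
            ‖UnboundedOperators.heatKernel (E := E) a y‖ₑ ^ (1 : ℝ) := by
          rw [← ENNReal.rpow_add_of_nonneg _ _ (by linarith) zero_le_one, sub_add_cancel]
      _ ≤ M ^ (b - 1) * ‖UnboundedOperators.heatKernel (E := E) a y‖ₑ := by
          rw [ENNReal.rpow_one]
          gcongr
  calc ∫⁻ y, ‖UnboundedOperators.heatKernel (E := E) a y‖ₑ ^ b
      ≤ ∫⁻ y, M ^ (b - 1) * ‖UnboundedOperators.heatKernel (E := E) a y‖ₑ := lintegral_mono hpt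
    _ = M ^ (b - 1) := by
        rw [lintegral_const_mul' _ _ (ENNReal.rpow_ne_top_of_nonneg (by linarith)
          ENNReal.ofReal_ne_top), UnboundedOperators.lintegral_enorm_heatKernel ha, mul_one]
    _ = ENNReal.ofReal ((4 * π) ^ (-(n * (b - 1) / 2))) * ENNReal.ofReal (a ^ (-(n * (b - 1) / 2))) := by
        rw [hM, ENNReal.ofReal_rpow_of_nonneg (by positivity) (by linarith),
          ← Real.rpow_mul (by positivity), Real.mul_rpow (by positivity) ha.le,
          ENNReal.ofReal_mul (by positivity)]
        congr 2 <;> ring_nf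

omit [FiniteDimensional ℝ E] [MeasurableSpace E] [BorelSpace E] in
/-- The Gaussian pointwise bound for the gradient family, as a product `K₀ a^{-(n+1)/2} e^{-‖y‖²/8a}`
with `K₀ = (4π)^{-n/2} ‖v‖`: `|∂ᵥG_a(y)| ≤ (4π)^{-n/2} ‖v‖ a^{-(n+1)/2} e^{-‖y‖²/(8a)}`
(the tree's `norm_fderiv_heatKernel_le`). [folklore] -/
theorem abs_heatKernelGrad_le_gaussian {a : ℝ} (ha : 0 < a) (v y : E) :
    |heatKernelGrad v a y| ≤
      ((4 * π) ^ (-(Module.finrank ℝ E : ℝ) / 2) * ‖v‖) *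
        a ^ (-(((Module.finrank ℝ E : ℝ) + 1) / 2)) * Real.exp (-(1 / (8 * a)) * ‖y‖ ^ 2) := by
  set n : ℝ := (Module.finrank ℝ E : ℝ) with hn
  have h1 : |heatKernelGrad v a y| ≤ ‖fderiv ℝ (UnboundedOperators.heatKernel a) y‖ * ‖v‖ := by
    rw [← Real.norm_eq_abs]
    exact (fderiv ℝ (UnboundedOperators.heatKernel a) y).le_opNorm v
  have h2 := UnboundedOperators.norm_fderiv_heatKernel_le (E := E) ha y
  -- rewrite `(4πa)^{-n/2} (√a)⁻¹` as `(4π)^{-n/2} a^{-(n+1)/2}`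
  have hpow : (4 * π * a) ^ (-n / 2) * (Real.sqrt a)⁻¹ = (4 * π) ^ (-n / 2) * a ^ (-((n + 1) / 2)) := by
    rw [Real.mul_rpow (by positivity) ha.le, Real.sqrt_eq_rpow, ← Real.rpow_neg ha.le, mul_assoc,
      ← Real.rpow_add ha]
    congr 2; ring
  calc |heatKernelGrad v a y| ≤ ‖fderiv ℝ (UnboundedOperators.heatKernel a) y‖ * ‖v‖ := h1
    _ ≤ (4 * π * a) ^ (-n / 2) * (Real.sqrt a)⁻¹ * Real.exp (-(1 / (8 * a)) * ‖y‖ ^ 2) * ‖v‖ :=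
        mul_le_mul_of_nonneg_right h2 (norm_nonneg _)
    _ = ((4 * π) ^ (-n / 2) * ‖v‖) * a ^ (-((n + 1) / 2)) * Real.exp (-(1 / (8 * a)) * ‖y‖ ^ 2) := by
        rw [hpow]; ring

/-- **`∫ |∂ᵥG_a|^b ≤ C(n, b, v) a^{-(n(b-1)+b)/2}`** for `a > 0`, `b > 0`, with
`C = ((4π)^{-n/2}‖v‖)^b (π/(b/8))^{n/2}` (integrate the `b`-th power of the Gaussian bound,
`∫ e^{-c‖y‖²} dy = (π/c)^{n/2}`; Robinson–Rodrigo–Sadowski 2016, Thm. D.4 (D.7) / Thm. D.7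
proof: "attaching the derivative to the kernel"). [cite: RobinsonRodrigoSadowskiCUP2016, Thm. D.7 proof (p. 296)] -/
theorem lintegral_rpow_enorm_heatKernelGrad_le {a : ℝ} (ha : 0 < a) {b : ℝ} (hb : 0 < b) (v : E) :
    ∫⁻ y, ‖heatKernelGrad v a y‖ₑ ^ b ≤
      ENNReal.ofReal ((((4 * π) ^ (-(Module.finrank ℝ E : ℝ) / 2) * ‖v‖) ^ b) *
          (π / (b / 8)) ^ ((Module.finrank ℝ E : ℝ) / 2)) *
        ENNReal.ofReal (a ^ (-(((Module.finrank ℝ E : ℝ) * (b - 1) + b) / 2))) := by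
  set n : ℝ := (Module.finrank ℝ E : ℝ) with hn
  set K₀ : ℝ := (4 * π) ^ (-n / 2) * ‖v‖ with hK₀
  have hK₀0 : 0 ≤ K₀ := by positivity
  set A : ℝ := K₀ * a ^ (-((n + 1) / 2)) with hA
  have hA0 : 0 ≤ A := by positivity
  have hc : 0 < b / (8 * a) := by positivity
  -- pointwise bound on the `b`-th powers
  have hpt : ∀ y : E, ‖heatKernelGrad v a y‖ₑ ^ b ≤
      ENNReal.ofReal (A ^ b * Real.exp (-(b / (8 * a)) * ‖y‖ ^ 2)) := by
    intro y
    have h := abs_heatKernelGrad_le_gaussian ha v y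
    rw [Real.enorm_eq_ofReal_abs, ENNReal.ofReal_rpow_of_nonneg (abs_nonneg _) hb.le]
    refine ENNReal.ofReal_le_ofReal ?_
    calc |heatKernelGrad v a y| ^ b ≤ (A * Real.exp (-(1 / (8 * a)) * ‖y‖ ^ 2)) ^ b :=
          Real.rpow_le_rpow (abs_nonneg _) (by rw [hA]; exact h) hb.le
      _ = A ^ b * Real.exp (-(b / (8 * a)) * ‖y‖ ^ 2) := by
          rw [Real.mul_rpow hA0 (Real.exp_nonneg _), ← Real.exp_mul]
          congr 2; ring
  -- integrate the Gaussian
  have hgi : Integrable (fun y : E => A ^ b * Real.exp (-(b / (8 * a)) * ‖y‖ ^ 2)) :=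
    (UnboundedOperators.integrable_gaussian_of_pos hc).const_mul _
  have hint : ∫⁻ y, ENNReal.ofReal (A ^ b * Real.exp (-(b / (8 * a)) * ‖(y : E)‖ ^ 2)) =
      ENNReal.ofReal (A ^ b * (π / (b / (8 * a))) ^ (n / 2)) := by
    rw [← ofReal_integral_eq_lintegral_ofReal hgi (Eventually.of_forall fun y => by positivity),
      integral_const_mul, GaussianFourier.integral_rexp_neg_mul_sq_norm hc]
  -- exponent bookkeeping
  have halg : A ^ b * (π / (b / (8 * a))) ^ (n / 2) =
      (K₀ ^ b * (π / (b / 8)) ^ (n / 2)) * a ^ (-((n * (b - 1) + b) / 2)) := by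
    have e1 : A ^ b = K₀ ^ b * a ^ (-((n + 1) / 2) * b) := by
      rw [hA, Real.mul_rpow hK₀0 (Real.rpow_nonneg ha.le _), ← Real.rpow_mul ha.le]
    have e2 : (π / (b / (8 * a))) ^ (n / 2) = (π / (b / 8)) ^ (n / 2) * a ^ (n / 2) := by
      rw [← Real.mul_rpow (by positivity) ha.le]
      congr 1
      field_simp
    rw [e1, e2]
    have e3 : a ^ (-((n + 1) / 2) * b) * a ^ (n / 2) = a ^ (-((n * (b - 1) + b) / 2)) := by
      rw [← Real.rpow_add ha]
      congr 1; ring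
    calc K₀ ^ b * a ^ (-((n + 1) / 2) * b) * ((π / (b / 8)) ^ (n / 2) * a ^ (n / 2))
        = K₀ ^ b * (π / (b / 8)) ^ (n / 2) * (a ^ (-((n + 1) / 2) * b) * a ^ (n / 2)) := by ring
      _ = K₀ ^ b * (π / (b / 8)) ^ (n / 2) * a ^ (-((n * (b - 1) + b) / 2)) := by rw [e3]
  calc ∫⁻ y, ‖heatKernelGrad v a y‖ₑ ^ b
      ≤ ∫⁻ y, ENNReal.ofReal (A ^ b * Real.exp (-(b / (8 * a)) * ‖(y : E)‖ ^ 2)) :=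
        lintegral_mono hpt
    _ = ENNReal.ofReal (A ^ b * (π / (b / (8 * a))) ^ (n / 2)) := hint
    _ = ENNReal.ofReal (K₀ ^ b * (π / (b / 8)) ^ (n / 2)) *
          ENNReal.ofReal (a ^ (-((n * (b - 1) + b) / 2))) := by
        rw [halg, ENNReal.ofReal_mul (by positivity)]

/-! ### The two memberships -/

/-- Numerical fact: `b < 1 + 2/n` gives `n(b - 1)/2 < 1` for `n ≥ 0` (also when `n = 0`). [folklore] -/
theorem heat_exponent_lt_one {n b : ℝ} (hn : 0 ≤ n) (hb : b < 1 + 2 / n) :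
    n * (b - 1) / 2 < 1 := by
  rcases hn.eq_or_lt with h | h
  · rw [← h]; norm_num
  · have : b - 1 < 2 / n := by linarith
    have h2 : n * (b - 1) < 2 := by
      calc n * (b - 1) < n * (2 / n) := by gcongr
        _ = 2 := by field_simp
    linarith

/-- Numerical fact: `b < 1 + 1/(n+1)` gives `(n(b - 1) + b)/2 < 1` for `n ≥ 0`. [folklore] -/
theorem heatGrad_exponent_lt_one {n b : ℝ} (hn : 0 ≤ n) (hb : b < 1 + 1 / (n + 1)) :
    (n * (b - 1) + b) / 2 < 1 := by
  have hn1 : 0 < n + 1 := by linarith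
  have : b - 1 < 1 / (n + 1) := by linarith
  have h2 : (n + 1) * (b - 1) < 1 := by
    calc (n + 1) * (b - 1) < (n + 1) * (1 / (n + 1)) := by gcongr
      _ = 1 := by field_simp
  nlinarith

/-- **The time-truncated backward heat kernel is in `L^b(ℝ × E)` for `1 ≤ b < 1 + 2/n`**
(`n = dim E`; in `ℝ³`: `b < 5/3`), `0 < T`: the isotropic exponent range of
Robinson–Rodrigo–Sadowski 2016, Thm. D.6, Case 2 (`n/l < n/r + 2` with `1 + 1/r = 1/b + 1/l`).
[cite: RobinsonRodrigoSadowskiCUP2016, Thm. D.6 proof, Case 2 (p. 295)] -/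
theorem memLp_indicator_strip_backKernel_heatKernel {b : ℝ≥0∞} (hb1 : 1 ≤ b) (hbtop : b ≠ ⊤)
    (hb : b.toReal < 1 + 2 / (Module.finrank ℝ E : ℝ)) {T : ℝ} (hT : 0 < T) :
    MemLp ((Ioo (-T) 0 ×ˢ (univ : Set E)).indicator
      (backKernel (UnboundedOperators.heatKernel (E := E)))) b (volume : Measure (ℝ × E)) := by
  set n : ℝ := (Module.finrank ℝ E : ℝ) with hn
  have hb1' : 1 ≤ b.toReal := by
    simpa using (ENNReal.toReal_le_toReal ENNReal.one_ne_top hbtop).2 hb1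
  have hθ : n * (b.toReal - 1) / 2 < 1 := heat_exponent_lt_one (by positivity) hb
  refine memLp_indicator_strip_backKernel (measurable_backKernel continuousOn_heatKernel_family)
    hb1 hbtop hT hθ (C := ENNReal.ofReal ((4 * π) ^ (-(n * (b.toReal - 1) / 2))))
    ENNReal.ofReal_ne_top fun a ha _ => ?_
  exact lintegral_rpow_enorm_heatKernel_le ha hb1'

/-- **The time-truncated backward heat-gradient kernel is in `L^b(ℝ × E)` for
`1 ≤ b < 1 + 1/(n+1)`** (`= (n+2)/(n+1)`; in `ℝ³`: `b < 5/4`), `0 < T`: the isotropic exponent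
range of Robinson–Rodrigo–Sadowski 2016, Thm. D.7 (`n/m < n/r + 1` with `1 + 1/r = 1/b + 1/m`).
[cite: RobinsonRodrigoSadowskiCUP2016, Thm. D.7 proof (p. 296)] -/
theorem memLp_indicator_strip_backKernel_heatKernelGrad (v : E) {b : ℝ≥0∞} (hb1 : 1 ≤ b)
    (hbtop : b ≠ ⊤) (hb : b.toReal < 1 + 1 / ((Module.finrank ℝ E : ℝ) + 1)) {T : ℝ} (hT : 0 < T) :
    MemLp ((Ioo (-T) 0 ×ˢ (univ : Set E)).indicator (backKernel (heatKernelGrad v))) b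
      (volume : Measure (ℝ × E)) := by
  set n : ℝ := (Module.finrank ℝ E : ℝ) with hn
  have hb0 : b ≠ 0 := (zero_lt_one.trans_le hb1).ne'
  have hbpos : 0 < b.toReal := ENNReal.toReal_pos hb0 hbtop
  have hθ : (n * (b.toReal - 1) + b.toReal) / 2 < 1 := heatGrad_exponent_lt_one (by positivity) hb
  refine memLp_indicator_strip_backKernel (measurable_backKernel (continuousOn_heatKernelGrad_family v))
    hb1 hbtop hT hθ
    (C := ENNReal.ofReal ((((4 * π) ^ (-n / 2) * ‖v‖) ^ b.toReal) * (π / (b.toReal / 8)) ^ (n / 2)))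
    ENNReal.ofReal_ne_top fun a ha _ => ?_
  exact lintegral_rpow_enorm_heatKernelGrad_le ha hbpos v

end Literature.Analysis.FluidPDE
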